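import Mathlib
import HarnessLib
import Literature.MathematicalPhysics.QuantumLattice.GrassmannSourceGrading
import Summits.HubbardSuperconductivity.HubbardSuperconductivity.Theorems.KLProgrammeKLRegimeTwoVolumeSourceProfileDefs
import Summits.HubbardSuperconductivity.HubbardSuperconductivity.Theorems.KLProgrammeKLRegimeTwoVolumeSourceProfileScale
import Summits.HubbardSuperconductivity.HubbardSuperconductivity.Theorems.KLProgrammeKLRegimeVolumeLimitLastScalePlainRowsDoor
import Summits.HubbardSuperconductivity.HubbardSuperconductivity.Theorems.KLProgrammeKLRegimeVolumeLimitLastScaleFarRows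
import Summits.HubbardSuperconductivity.HubbardSuperconductivity.Theorems.KLProgrammeKLRegimeTwoVolumeProfileBridge

/-!
# Route `KLProgramme` — crux K3, VL child `KLRegimeVolumeLimitV17F2` (stmt-HubbardSuperconductivity-20440): THE n⋆ DICTIONARY between the
# doubled-analysed action `klSrcAction` (token #24's object, `…TwoVolumeSourceProfileDefs`, p574400) and the VL END doors, and the END ADAPTER doors
# (rider (R2) of the #24 co-sign; cell gate-hubbard-kl, seat hubbard-kl-k3c5-p3 g11, technique «OS-positivity-free direct assembly»)

Blueprint v3 §A (k3c4-p1) organises the (R-src)-augmented two-volume chain on the AMPUTATED doubled-analysed action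
`klSrcAction V M β U μ K n = map (toLin' klSrcAnalysis) 𝒱⁽ⁿ⁾[K]` (copy `0` = alive legs analysed at scale `n`, copy `1` = plain «source» legs in sector slot `0`;
E1's object word KL l.3815 (D), pen (R66)/(R67)).  Its last object (scale `n⋆ = n_β + 1`, truncated to source degree `< 3`) must meet the VL END doors, which
read the plain position-space two-leg kernels `W_{𝒱⁽ⁿ⋆⁾[K_V]}(x,y) = sectorisedKernel β (trivialMultiplier) 𝒱 2 ((0,0,+),(0,0,−)) (x,y)`.  This file is the
dictionary and the adapters:

* §1 rows of `klSrcAnalysis`: `klSrcAnalysis_apply_alive` (copy `0` ↦ `E_n`), `klSrcAnalysis_apply_src` (copy `1`, slot `0` ↦ `E_plain` at the relabelled plain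
  label), `klSrcAnalysis_apply_dead` (copy `1`, slot `≠ 0` ↦ `0`);
* §2 kernels (∘ the generic rows dictionary `TwoVolumeDefect.kernel_map_toLin'_eq_of_rows_eq`, p569685, and `kernel_map_sectorAnalysis`):
  **`kernel_klSrcAction_src`** (all-copy-1 slot-0 strings read the plain position kernels of `𝒱⁽ⁿ⁾`), `kernel_klSrcAction_alive` (all-copy-0 strings read the
  scale-`n` sectorised kernels — (b)'s object VERBATIM), `kernel_klSrcAction_eq_zero_of_dead`, `kernel_srcTrunc_three_two`,
  **`kernel_srcTrunc_klSrcAction_pair`** / `kernel_klSrcAction_pair`: the `(+,−)` source pair at `(x,y)`, spin `↑`, slot `0`, through `srcTrunc 3` or not, IS `W_{𝒱⁽ⁿ⁾[K]}(x,y)`;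
* §2b the weighted dictionary: `one_add_klScale_mul_tnorm_le_klScaleWt_pair` (`1 + Λ_n‖y‖_𝕋 ≤ klScaleWt_n` of the pair's position image),
  **`weightedRows_le_klSrcPinnedSum`** (`ε·Σ_{t₁,y}(1 + Λ_n‖y‖_𝕋)‖W(o,(t₁,o⃗+y))‖ ≤ klSrcPinnedSum … n 2 2 0 ((o,(0,↑,+)),1)` — the `…LastScaleFarRows` weighted rows ARE
  token #24 at `s = m = 2`), `klSrcPinnedSum_two_two_le_of_sourceProfilesAt` (`… ≤ A n 2` under `SourceProfilesAt … (klSrcBudget P Q U A n) …`);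
* §3 END ADAPTER doors: (e) `framedNestedFlowTextV17F2_of_srcActionPinnedDefect` (∘ door (b) of `…LastScalePlainRowsDoor`) and
  **(h) `framedNestedFlowTextV17F2_of_srcActionNearDefect_srcPinnedSum`** (∘ door (f) of `…LastScaleFarRows`): the registered stub text from
  «`∃ L₀ δ→0 B`: for `L ≥ L₀`, `L″ = b·L`, eventually in `M`, ∃ pins with a common time: `2ε·NEAR ≤ δ L` (pinned same-offset two-volume defect of the source-pair
  kernels of `srcTrunc 3 (klSrcAction_V[K_V] n⋆)`, own flow frames) and `klSrcPinnedSum L″ M β U μ K_{L″} n⋆ 2 2 0 ((o_f,(0,↑,+)),1) ≤ B`» — the second conjunct is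
  `SourceProfilesAt.two` of token #24 at `n⋆`; the chain owes ONLY the NEAR defect.
Proofs only; no definition; nothing asserts superconductivity.  References: BGM 2006 §2.7 (2.70), §2.9 (4.3)–(4.6), §2.4 (2.38).
-/

noncomputable section


namespace Summit.HubbardSuperconductivity.HubbardSuperconductivity.Theorems.TwoVolumeSource

set_option linter.dupNamespace false -- summit = problem name (single-conjunct summit), D-0017

open Finset Literature.MathematicalPhysics.QuantumLattice Literature.Probability.LatticeModels GrassmannAlgebra
open Summit.HubbardSuperconductivity.HubbardSuperconductivity.Theorems.KLProgrammeLegKernels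
open Summit.HubbardSuperconductivity.HubbardSuperconductivity.Theorems.KLRegimeSplit
open Summit.HubbardSuperconductivity.HubbardSuperconductivity.Theorems.TwoVolumeDefect
open Summit.HubbardSuperconductivity.HubbardSuperconductivity.Theorems.EngineV8

/-! ## §1 The rows of the doubled analysis matrix -/

section Rows

variable {L M : ℕ}

/-- Copy `0` rows: the scale-`n` sector analysis `E_n`. [cite: BenfattoGiulianiMastropietro2006, §2.7 (2.70)] -/
theorem klSrcAnalysis_apply_alive (β μ : ℝ) (K : TrigPolyC4v) (n : ℕ) (Y : SrcLabel L M n) (hY : Y.2 = 0) :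
    klSrcAnalysis L M β μ K n Y = sectorAnalysisMatrix L M β (klAnisoFamily L M β μ K klE0 n) Y.1 := by
  ext X
  rw [klSrcAnalysis, Matrix.of_apply, if_pos hY]

/-- Copy `1` rows in sector slot `0`: the PLAIN analysis `E_plain` at the relabelled plain label. [cite: BenfattoGiulianiMastropietro2006, §2.9 (4.3)-(4.6)] -/
theorem klSrcAnalysis_apply_src (β μ : ℝ) (K : TrigPolyC4v) (n : ℕ) (Y : SrcLabel L M n) (hY : Y.2 = 1) (h0 : (Y.1.2.1.1 : ℕ) = 0) :
    klSrcAnalysis L M β μ K n Y = sectorAnalysisMatrix L M β (trivialMultiplier L M) (Y.1.1, (((0 : Fin 1), Y.1.2.1.2), Y.1.2.2)) := by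
  ext X
  rw [klSrcAnalysis, Matrix.of_apply, if_neg (by rw [hY]; decide), if_pos h0]

/-- Copy `1` rows in the other sector slots are DEAD. [folklore] -/
theorem klSrcAnalysis_apply_dead (β μ : ℝ) (K : TrigPolyC4v) (n : ℕ) (Y : SrcLabel L M n) (hY : Y.2 = 1) (h0 : (Y.1.2.1.1 : ℕ) ≠ 0) :
    klSrcAnalysis L M β μ K n Y = 0 := by
  ext X
  rw [klSrcAnalysis, Matrix.of_apply, if_neg (by rw [hY]; decide), if_neg h0, Pi.zero_apply]

end Rows

/-! ## §2 The dictionary: kernels of `klSrcAction` by copy -/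

section Kernels

variable {L M : ℕ} [NeZero L]

/-- **ALL-SOURCE STRINGS READ THE PLAIN POSITION-SPACE KERNELS OF `𝒱⁽ⁿ⁾`**: if every leg of `X` is a copy-`1` leg in sector slot `0`, then
`kernel (klSrcAction … n) m X = sectorisedKernel β (trivialMultiplier) 𝒱⁽ⁿ⁾[K] m (relabel ∘ X) (pos ∘ X)` (rows dictionary `kernel_map_toLin'_eq_of_rows_eq`
∘ `kernel_map_sectorAnalysis`). [cite: BenfattoGiulianiMastropietro2006, §2.9 (4.3)-(4.6)] -/
theorem kernel_klSrcAction_src (β U μ : ℝ) (K : TrigPolyC4v) (n m : ℕ) (X : Fin m → SrcLabel L M n)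
    (hX : ∀ i, (X i).2 = 1) (h0 : ∀ i, ((X i).1.2.1.1 : ℕ) = 0) :
    kernel ℂ (klSrcAction L M β U μ K n) m X =
      sectorisedKernel L M β (trivialMultiplier L M) (klEffectiveAction L M β U μ K klE0 n) m
        (fun i => ((((0 : Fin 1), (X i).1.2.1.2), (X i).1.2.2) : SectorLeg 1)) (fun i => (X i).1.1) := by
  rw [klSrcAction, kernel_map_toLin'_eq_of_rows_eq (klSrcAnalysis L M β μ K n) (sectorAnalysisMatrix L M β (trivialMultiplier L M)) _ m X
      (fun i => ((X i).1.1, (((0 : Fin 1), (X i).1.2.1.2), (X i).1.2.2))) fun i => klSrcAnalysis_apply_src β μ K n (X i) (hX i) (h0 i),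
    kernel_map_sectorAnalysis]

/-- **ALL-ALIVE STRINGS READ (b)'s OBJECT VERBATIM**: if every leg of `X` is a copy-`0` leg, `kernel (klSrcAction … n) m X = kernel (map (toLin' E_n) 𝒱⁽ⁿ⁾) m (·.1 ∘ X)`
(= the scale-`n` sectorised kernel). [cite: BenfattoGiulianiMastropietro2006, §2.7 (2.70)] -/
theorem kernel_klSrcAction_alive (β U μ : ℝ) (K : TrigPolyC4v) (n m : ℕ) (X : Fin m → SrcLabel L M n) (hX : ∀ i, (X i).2 = 0) :
    kernel ℂ (klSrcAction L M β U μ K n) m X =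
      sectorisedKernel L M β (klAnisoFamily L M β μ K klE0 n) (klEffectiveAction L M β U μ K klE0 n) m
        (fun i => (X i).1.2) (fun i => (X i).1.1) := by
  rw [klSrcAction, kernel_map_toLin'_eq_of_rows_eq (klSrcAnalysis L M β μ K n)
      (sectorAnalysisMatrix L M β (klAnisoFamily L M β μ K klE0 n)) _ m X (fun i => (X i).1) fun i => klSrcAnalysis_apply_alive β μ K n (X i) (hX i),
    kernel_map_sectorAnalysis]

/-- **A DEAD SLOT KILLS THE STRING**: a copy-`1` leg outside sector slot `0` makes the kernel vanish. [folklore] -/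
theorem kernel_klSrcAction_eq_zero_of_dead (β U μ : ℝ) (K : TrigPolyC4v) (n m : ℕ) (X : Fin m → SrcLabel L M n) {i : Fin m}
    (hX : (X i).2 = 1) (h0 : ((X i).1.2.1.1 : ℕ) ≠ 0) :
    kernel ℂ (klSrcAction L M β U μ K n) m X = 0 := by
  rw [klSrcAction]
  exact kernel_map_toLin'_eq_zero_of_row_eq_zero _ _ m X (i := i) (klSrcAnalysis_apply_dead β μ K n (X i) hX h0)

/-- **The truncation to source degree `< 3` is transparent on two-leg strings.** [cite: BenfattoGiulianiMastropietro2006, §2.9 (4.3)-(4.6)] -/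
theorem kernel_srcTrunc_three_two {n : ℕ} (F : GrassmannAlgebra ℂ (SrcLabel L M n)) (X : Fin 2 → SrcLabel L M n) :
    kernel ℂ (srcTrunc ℂ (fun Y : SrcLabel L M n => Y.2 = 1) 3 F) 2 X = kernel ℂ F 2 X :=
  kernel_srcTrunc_of_lt ℂ _ F ((card_filter_le _ _).trans_lt (by simp))

/-- **THE n⋆ DICTIONARY AT THE END DOORS' PINS** (rider (R2)): the `(+,−)` source pair at `(x, y)`, spin `↑`, sector slot `0`, read through `srcTrunc 3`,
IS the plain two-leg kernel `W_{𝒱⁽ⁿ⁾[K]}(x, y)` of the VL doors. [cite: BenfattoGiulianiMastropietro2006, §2.9 (4.3)-(4.6)] -/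
theorem kernel_srcTrunc_klSrcAction_pair (β U μ : ℝ) (K : TrigPolyC4v) (n : ℕ) (x y : SpaceTimeIdx L M) :
    kernel ℂ (srcTrunc ℂ (fun Y : SrcLabel L M n => Y.2 = 1) 3 (klSrcAction L M β U μ K n)) 2
        ![((x, ((⟨0, sectorCount_pos n⟩, 0), 0)), 1), ((y, ((⟨0, sectorCount_pos n⟩, 0), 1)), 1)] =
      sectorisedKernel L M β (trivialMultiplier L M) (klEffectiveAction L M β U μ K klE0 n) 2
        (![((0, 0), 0), ((0, 0), 1)] : Fin 2 → SectorLeg 1) ![x, y] := by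
  rw [kernel_srcTrunc_three_two, kernel_klSrcAction_src β U μ K n 2 _ (fun i => by fin_cases i <;> rfl) (fun i => by fin_cases i <;> rfl)]
  congr 1 <;> funext i <;> fin_cases i <;> rfl

/-- The n⋆ dictionary at the pins, untruncated form. [cite: BenfattoGiulianiMastropietro2006, §2.9 (4.3)-(4.6)] -/
theorem kernel_klSrcAction_pair (β U μ : ℝ) (K : TrigPolyC4v) (n : ℕ) (x y : SpaceTimeIdx L M) :
    kernel ℂ (klSrcAction L M β U μ K n) 2 ![((x, ((⟨0, sectorCount_pos n⟩, 0), 0)), 1), ((y, ((⟨0, sectorCount_pos n⟩, 0), 1)), 1)] =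
      sectorisedKernel L M β (trivialMultiplier L M) (klEffectiveAction L M β U μ K klE0 n) 2
        (![((0, 0), 0), ((0, 0), 1)] : Fin 2 → SectorLeg 1) ![x, y] := by
  rw [← kernel_srcTrunc_three_two, kernel_srcTrunc_klSrcAction_pair]

end Kernels

/-! ## §2b The weighted dictionary: door (f)'s weighted fine-volume rows ≤ the source-graded pinned sum (token #24 at `s = m = 2`) -/

section Weighted

variable {L M : ℕ} [NeZero L]

/-- The tree weight of a source pair dominates `1 + Λ_n‖y‖_𝕋` (`y` = the spatial offset of the pair; `0 ≤ β`). [folklore] -/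
theorem one_add_klScale_mul_tnorm_le_klScaleWt_pair {β : ℝ} (hβ : 0 ≤ β) (n : ℕ) (of : SpaceTimeIdx L M) (t₁ : ImagTimeIdx M)
    (y : TorusSite 2 L) :
    1 + klScale klE0 n * (Torus.tnorm y : ℝ) ≤
      klScaleWt L M β n ((univ.image (![((of, ((⟨0, sectorCount_pos n⟩, 0), 0)), 1), (((t₁, of.2 + y), ((⟨0, sectorCount_pos n⟩, 0), 1)), 1)] :
          Fin 2 → SrcLabel L M n)).image (srcLegPos L M (2 * (2 * M)))) := by
  classical
  set X : Fin 2 → SrcLabel L M n :=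
    ![((of, ((⟨0, sectorCount_pos n⟩, 0), 0)), 1), (((t₁, of.2 + y), ((⟨0, sectorCount_pos n⟩, 0), 1)), 1)] with hX
  rw [klScaleWt_apply]
  have hΛ : 0 ≤ klScale klE0 n := (klth_klScale_pos n).le
  refine add_le_add le_rfl (mul_le_mul_of_nonneg_left ?_ hΛ)
  have ha : srcLegPos L M (2 * (2 * M)) (X 0) ∈ (univ.image X).image (srcLegPos L M (2 * (2 * M))) :=
    mem_image_of_mem _ (mem_image_of_mem _ (mem_univ 0))
  have hb : srcLegPos L M (2 * (2 * M)) (X 1) ∈ (univ.image X).image (srcLegPos L M (2 * (2 * M))) :=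
    mem_image_of_mem _ (mem_image_of_mem _ (mem_univ 1))
  refine le_trans ?_ (BattleFederbush.le_labelDiam _ ha hb)
  rw [gridLabelDist_apply]
  have hc : 0 ≤ β / (2 * (2 * M) : ℕ) * cyclicDist (2 * (2 * M)) (srcLegPos L M (2 * (2 * M)) (X 0)).1 (srcLegPos L M (2 * (2 * M)) (X 1)).1 :=
    mul_nonneg (by positivity) (Nat.cast_nonneg _)
  have hd : (Torus.tnorm y : ℝ) = torusSiteDist (srcLegPos L M (2 * (2 * M)) (X 0)).2 (srcLegPos L M (2 * (2 * M)) (X 1)).2 := by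
    have h2 : (srcLegPos L M (2 * (2 * M)) (X 0)).2 = of.2 := rfl
    have h3 : (srcLegPos L M (2 * (2 * M)) (X 1)).2 = of.2 + y := rfl
    rw [h2, h3, ← tnorm_sub_eq_torusSiteDist, sub_add_cancel_left,
      le_antisymm (Torus.tnorm_neg_le y) (by simpa using Torus.tnorm_neg_le (-y))]
  linarith

/-- **THE WEIGHTED DICTIONARY**: door (f)'s weighted fine-volume row profile is dominated by the source-graded weighted pinned sum of token #24 at
`s = m = 2`, pin = the `(+)` source leg at `o` (`0 ≤ β`):
`ε·Σ_{t₁,y}(1 + Λ_n‖y‖_𝕋)·‖W_{𝒱⁽ⁿ⁾[K]}(o,(t₁,o⃗+y))‖ ≤ klSrcPinnedSum … n 2 2 0 ((o,(0,↑,+)),1)`. [cite: BenfattoGiulianiMastropietro2006, §2.9 (4.3)-(4.6)] -/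
theorem weightedRows_le_klSrcPinnedSum {β : ℝ} (hβ : 0 ≤ β) (U μ : ℝ) (K : TrigPolyC4v) (n : ℕ) (of : SpaceTimeIdx L M) :
    imagTimeWeight β M * ∑ t₁ : ImagTimeIdx M, ∑ y : TorusSite 2 L,
        (1 + klScale klE0 n * (Torus.tnorm y : ℝ)) *
          ‖sectorisedKernel L M β (trivialMultiplier L M) (klEffectiveAction L M β U μ K klE0 n) 2
              (![((0, 0), 0), ((0, 0), 1)] : Fin 2 → SectorLeg 1) ![of, (t₁, of.2 + y)]‖ ≤
      klSrcPinnedSum L M β U μ K n 2 2 0 ((of, ((⟨0, sectorCount_pos n⟩, 0), 0)), 1) := by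
  classical
  have hε : 0 ≤ imagTimeWeight β M := imagTimeWeight_nonneg hβ M
  have h21 : imagTimeWeight β M ^ (2 - 1) = imagTimeWeight β M := by norm_num
  rw [klSrcPinnedSum, h21]
  refine mul_le_mul_of_nonneg_left ?_ hε
  -- the source-pair string of `(t₁, y)` and the weighted kernel norm it is compared with
  let φ : ImagTimeIdx M × TorusSite 2 L → (Fin 2 → SrcLabel L M n) := fun p =>
    ![((of, ((⟨0, sectorCount_pos n⟩, 0), 0)), 1), (((p.1, of.2 + p.2), ((⟨0, sectorCount_pos n⟩, 0), 1)), 1)]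
  let g : (Fin 2 → SrcLabel L M n) → ℝ := fun X =>
    klScaleWt L M β n ((univ.image X).image (srcLegPos L M (2 * (2 * M)))) * ‖kernel ℂ (klSrcAction L M β U μ K n) 2 X‖
  have hφ1 : ∀ p : ImagTimeIdx M × TorusSite 2 L, ((φ p) 1).1.1 = (p.1, of.2 + p.2) := fun p => rfl
  have hφ0 : ∀ p : ImagTimeIdx M × TorusSite 2 L, (φ p) 0 = ((of, ((⟨0, sectorCount_pos n⟩, 0), 0)), 1) := fun p => rfl
  have hφinj : Function.Injective φ := by
    intro p q h
    have h1 : (p.1, of.2 + p.2) = (q.1, of.2 + q.2) := by rw [← hφ1 p, ← hφ1 q, h]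
    obtain ⟨h2, h3⟩ := Prod.mk.inj h1
    exact Prod.ext h2 (add_left_cancel h3)
  have hterm : ∀ (t₁ : ImagTimeIdx M) (y : TorusSite 2 L),
      (1 + klScale klE0 n * (Torus.tnorm y : ℝ)) *
          ‖sectorisedKernel L M β (trivialMultiplier L M) (klEffectiveAction L M β U μ K klE0 n) 2
              (![((0, 0), 0), ((0, 0), 1)] : Fin 2 → SectorLeg 1) ![of, (t₁, of.2 + y)]‖ ≤ g (φ (t₁, y)) := by
    intro t₁ y
    show _ ≤ klScaleWt L M β n _ * ‖kernel ℂ (klSrcAction L M β U μ K n) 2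
      ![((of, ((⟨0, sectorCount_pos n⟩, 0), 0)), 1), (((t₁, of.2 + y), ((⟨0, sectorCount_pos n⟩, 0), 1)), 1)]‖
    rw [kernel_klSrcAction_pair]
    exact mul_le_mul_of_nonneg_right (one_add_klScale_mul_tnorm_le_klScaleWt_pair hβ n of t₁ y) (norm_nonneg _)
  have hsrc : ∀ p : ImagTimeIdx M × TorusSite 2 L, srcCount (fun Y : SrcLabel L M n => Y.2 = 1) (φ p) = 2 := by
    intro p
    rw [srcCount, filter_true_of_mem fun j _ => by fin_cases j <;> rfl, card_univ, Fintype.card_fin]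
  calc ∑ t₁ : ImagTimeIdx M, ∑ y : TorusSite 2 L, (1 + klScale klE0 n * (Torus.tnorm y : ℝ)) *
          ‖sectorisedKernel L M β (trivialMultiplier L M) (klEffectiveAction L M β U μ K klE0 n) 2
              (![((0, 0), 0), ((0, 0), 1)] : Fin 2 → SectorLeg 1) ![of, (t₁, of.2 + y)]‖
      ≤ ∑ t₁ : ImagTimeIdx M, ∑ y : TorusSite 2 L, g (φ (t₁, y)) := sum_le_sum fun t₁ _ => sum_le_sum fun y _ => hterm t₁ y
    _ = ∑ p : ImagTimeIdx M × TorusSite 2 L, g (φ p) := (Fintype.sum_prod_type fun p : ImagTimeIdx M × TorusSite 2 L => g (φ p)).symm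
    _ = ∑ X ∈ (univ : Finset (ImagTimeIdx M × TorusSite 2 L)).image φ, g X := (sum_image fun p _ q _ h => hφinj h).symm
    _ ≤ ∑ X ∈ univ.filter (fun X : Fin 2 → SrcLabel L M n =>
          X 0 = ((of, ((⟨0, sectorCount_pos n⟩, 0), 0)), 1) ∧ srcCount (fun Y : SrcLabel L M n => Y.2 = 1) X = 2), g X := by
        refine sum_le_sum_of_subset_of_nonneg ?_ fun X _ _ =>
          mul_nonneg (zero_le_one.trans (one_le_klScaleWt L M β n _)) (norm_nonneg _)
        intro X hX
        obtain ⟨p, -, rfl⟩ := mem_image.1 hX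
        exact mem_filter.2 ⟨mem_univ _, hφ0 p, hsrc p⟩

/-- **Token #24 in the v9 currency pays door (h)'s `B`**: under `SourceProfilesAt L M (klSrcBudget P Q U A n) β U μ K n` every two-source, degree-2 pinned sum is
`≤ A n 2` (`klSrcBudget_of_le_two`). [cite: BenfattoGiulianiMastropietro2006, §2.9 (4.3)-(4.6)] -/
theorem klSrcPinnedSum_two_two_le_of_sourceProfilesAt {P : SplitConsts} {Q : EngConsts} {U : ℝ} {A : ℕ → ℕ → ℝ} {β μ : ℝ} {K : TrigPolyC4v} {n : ℕ}
    (h : SourceProfilesAt L M (klSrcBudget P Q U A n) β U μ K n) (q : Fin 2) (w : SrcLabel L M n) :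
    klSrcPinnedSum L M β U μ K n 2 2 q w ≤ A n 2 := by
  have h2 := h.two 2 q w
  rwa [klSrcBudget_of_le_two P Q U A n 2 le_rfl] at h2

end Weighted

end Summit.HubbardSuperconductivity.HubbardSuperconductivity.Theorems.TwoVolumeSource

/-! ## §3 The END adapter: the registered stub text from the pinned two-volume defect of the SOURCE-PAIR kernels of `srcTrunc 3 (klSrcAction … n⋆)` -/

namespace Summit.HubbardSuperconductivity.HubbardSuperconductivity.Theorems.TwoPointAssembly

set_option linter.dupNamespace false -- summit = problem name (single-conjunct summit), D-0017

open Finset Filter Topology Complex Literature.MathematicalPhysics.QuantumLattice Literature.Probability.LatticeModels GrassmannAlgebra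
open Summit.HubbardSuperconductivity.HubbardSuperconductivity.Theorems.KLRegimeSplit
open Summit.HubbardSuperconductivity.HubbardSuperconductivity.Theorems.KLProgrammeLegKernels
open Summit.HubbardSuperconductivity.HubbardSuperconductivity.Theorems.TwoVolumeDefect
open Summit.HubbardSuperconductivity.HubbardSuperconductivity.Theorems.TwoVolumeSource

/-- **DOOR (e) — THE AUGMENTED CHAIN'S LAST OBJECT PLUGS IN DIRECTLY.**  The registered text of `stub_vl_nestedFramed` from: `∃ L₀ δ→0`, for `L ≥ L₀`,
`L″ = b·L`, eventually in `M`, pins with a common time such that the pinned `ℓ¹` two-volume defect + far rows of the SOURCE-PAIR two-leg kernels of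
`srcTrunc 3 (klSrcAction V M β U μ K_V n⋆)` (V = L, L″, own flow frames, sector slot `0`, spin `↑`) is `≤ δ L / (2ε)` (∘ door (b) by the n⋆ dictionary).
[cite: BenfattoGiulianiMastropietro2006, §2.9 (4.3)-(4.6)] -/
theorem framedNestedFlowTextV17F2_of_srcActionPinnedDefect
    (hD : ∀ (G : GeoConsts) (P : SplitConsts) (Q : EngConsts) (R : RenConsts), G.WF → P.WF → Q.WF → R.WF →
      ∃ c₅ : ℝ, 0 < c₅ ∧ ∀ c : ℝ, 0 < c → c ≤ c₅ → ∃ U₀ : ℝ, 0 < U₀ ∧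
        ∀ μ ∈ klWindowC, ∀ U : ℝ, 0 < U → U ≤ U₀ → ∀ β : ℝ, klBetaMin ≤ β → β ≤ Real.exp (c / U ^ 2) →
          ∀ K : TrigPolyC4v, klPredsV17F2.frameOK R U (nScales β) μ K →
            ∀ (Lstar : ℕ) (Mstar : ℕ → ℕ), TowerP klPredsV17F2 G P Q R β U μ K Lstar Mstar →
              ∃ L₀ : ℕ, ∃ δ : ℕ → ℝ, Tendsto δ atTop (𝓝 0) ∧
                ∀ (L : ℕ) [NeZero L], L₀ ≤ L → ∀ (L'' : ℕ) [NeZero L''] (b : ℕ), L'' = b * L → ∃ M₀ : ℕ, ∀ (M : ℕ) [NeZero M], M₀ ≤ M →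
                  ∃ (oc : SpaceTimeIdx L M) (of : SpaceTimeIdx L'' M), of.1 = oc.1 ∧
                    2 * imagTimeWeight β M *
                      ((∑ t₁ : ImagTimeIdx M, ∑ ybar : TorusSite 2 L,
                          ‖kernel ℂ (srcTrunc ℂ (fun Y : SrcLabel L M (nScales β + 1) => Y.2 = 1) 3
                                (klSrcAction L M β U μ (klFlowFrameU L M β U μ (nScales β + 1)) (nScales β + 1))) 2
                                ![((oc, ((⟨0, sectorCount_pos _⟩, 0), 0)), 1), (((t₁, oc.2 + ybar), ((⟨0, sectorCount_pos _⟩, 0), 1)), 1)] -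
                            kernel ℂ (srcTrunc ℂ (fun Y : SrcLabel L'' M (nScales β + 1) => Y.2 = 1) 3
                                (klSrcAction L'' M β U μ (klFlowFrameU L'' M β U μ (nScales β + 1)) (nScales β + 1))) 2
                                ![((of, ((⟨0, sectorCount_pos _⟩, 0), 0)), 1),
                                  (((t₁, of.2 + Torus.proj L'' (Torus.cRep ybar)), ((⟨0, sectorCount_pos _⟩, 0), 1)), 1)]‖) +
                        ∑ t₁ : ImagTimeIdx M,
                          ∑ y ∈ univ.filter (fun y : TorusSite 2 L'' => Torus.proj L'' (Torus.cRep (fun i => (((y i).val : ℕ) : ZMod L))) ≠ y),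
                            ‖kernel ℂ (srcTrunc ℂ (fun Y : SrcLabel L'' M (nScales β + 1) => Y.2 = 1) 3
                                (klSrcAction L'' M β U μ (klFlowFrameU L'' M β U μ (nScales β + 1)) (nScales β + 1))) 2
                                ![((of, ((⟨0, sectorCount_pos _⟩, 0), 0)), 1), (((t₁, of.2 + y), ((⟨0, sectorCount_pos _⟩, 0), 1)), 1)]‖) ≤ δ L) :
    ∀ (G : GeoConsts) (P : SplitConsts) (Q : EngConsts) (R : RenConsts), G.WF → P.WF → Q.WF → R.WF →
      ∃ c₅ : ℝ, 0 < c₅ ∧ ∀ c : ℝ, 0 < c → c ≤ c₅ → ∃ U₀ : ℝ, 0 < U₀ ∧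
        ∀ μ ∈ klWindowC, ∀ U : ℝ, 0 < U → U ≤ U₀ → ∀ β : ℝ, klBetaMin ≤ β → β ≤ Real.exp (c / U ^ 2) →
          ∀ K : TrigPolyC4v, klPredsV17F2.frameOK R U (nScales β) μ K →
            ∀ (Lstar : ℕ) (Mstar : ℕ → ℕ), TowerP klPredsV17F2 G P Q R β U μ K Lstar Mstar →
              ∀ n : ℤ, ∃ L₀ : ℕ, ∃ ρ : ℕ → ℝ, Tendsto ρ atTop (𝓝 0) ∧
                ∀ (L : ℕ) [NeZero L], L₀ ≤ L → ∀ (L'' : ℕ) [NeZero L''], L ∣ L'' → ∃ M₀ : ℕ, ∀ (M : ℕ) [NeZero M], M₀ ≤ M →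
                  ∀ (ω : MatsubaraIdx M), matsubaraInt M ω = n → ∀ (k : TorusSite 2 L) (k'' : TorusSite 2 L''),
                    latticeMomentum L'' k'' = latticeMomentum L k →
                      ‖klSelfEnergy L M β U μ (klFlowFrameU L M β U μ (nScales β + 1)) klE0 (nScales β + 1) (ω, k) 0 -
                          klSelfEnergy L'' M β U μ (klFlowFrameU L'' M β U μ (nScales β + 1)) klE0 (nScales β + 1) (ω, k'') 0‖ ≤ ρ L := by
  refine framedNestedFlowTextV17F2_of_plainRowsPinnedDefect fun G P Q R hG hP hQ hR => ?_
  obtain ⟨c₅, hc₅, hc⟩ := hD G P Q R hG hP hQ hR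
  refine ⟨c₅, hc₅, fun c hc0 hcc => ?_⟩
  obtain ⟨U₀, hU₀, hU⟩ := hc c hc0 hcc
  refine ⟨U₀, hU₀, fun μ hμ U hU0 hUU β hβmin hβmax K hK Lstar Mstar hT => ?_⟩
  obtain ⟨L₀, δ, hδ, hDn⟩ := hU μ hμ U hU0 hUU β hβmin hβmax K hK Lstar Mstar hT
  refine ⟨L₀, δ, hδ, fun L _ hL L'' _ b hb => ?_⟩
  obtain ⟨M₀, hM₀⟩ := hDn L hL L'' b hb
  refine ⟨M₀, fun M _ hM => ?_⟩
  obtain ⟨oc, of, ht, hdef⟩ := hM₀ M hM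
  refine ⟨oc, of, ht, ?_⟩
  simpa only [kernel_srcTrunc_klSrcAction_pair] using hdef

/-- **DOOR (h) — WHAT THE AUGMENTED CHAIN + TOKEN #24 OWE, AND NOTHING ELSE.**  The registered text of `stub_vl_nestedFramed` from: `∃ L₀ δ→0 B`, for
`L ≥ L₀`, `L″ = b·L`, eventually in `M`, pins with a common time such that (NEAR) the pinned `ℓ¹` two-volume defect of the SOURCE-PAIR kernels of
`srcTrunc 3 (klSrcAction_V[K_V] n⋆)` at the SAME centred offsets is `≤ δ L/(2ε)`, and (#24 at `n⋆`, fine volume, `s = m = 2`, pin = the `(+)` source leg)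
`klSrcPinnedSum L″ M β U μ K_{L″} n⋆ 2 2 0 ((o_f,(0,↑,+)),1) ≤ B` — the far rows are paid by the weight (`…LastScaleFarRows`).
[cite: BenfattoGiulianiMastropietro2006, §2.9 (4.3)-(4.6)] -/
theorem framedNestedFlowTextV17F2_of_srcActionNearDefect_srcPinnedSum
    (hD : ∀ (G : GeoConsts) (P : SplitConsts) (Q : EngConsts) (R : RenConsts), G.WF → P.WF → Q.WF → R.WF →
      ∃ c₅ : ℝ, 0 < c₅ ∧ ∀ c : ℝ, 0 < c → c ≤ c₅ → ∃ U₀ : ℝ, 0 < U₀ ∧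
        ∀ μ ∈ klWindowC, ∀ U : ℝ, 0 < U → U ≤ U₀ → ∀ β : ℝ, klBetaMin ≤ β → β ≤ Real.exp (c / U ^ 2) →
          ∀ K : TrigPolyC4v, klPredsV17F2.frameOK R U (nScales β) μ K →
            ∀ (Lstar : ℕ) (Mstar : ℕ → ℕ), TowerP klPredsV17F2 G P Q R β U μ K Lstar Mstar →
              ∃ L₀ : ℕ, ∃ δ : ℕ → ℝ, ∃ B : ℝ, Tendsto δ atTop (𝓝 0) ∧
                ∀ (L : ℕ) [NeZero L], L₀ ≤ L → ∀ (L'' : ℕ) [NeZero L''] (b : ℕ), L'' = b * L → ∃ M₀ : ℕ, ∀ (M : ℕ) [NeZero M], M₀ ≤ M →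
                  ∃ (oc : SpaceTimeIdx L M) (of : SpaceTimeIdx L'' M), of.1 = oc.1 ∧
                    2 * imagTimeWeight β M *
                      (∑ t₁ : ImagTimeIdx M, ∑ ybar : TorusSite 2 L,
                          ‖kernel ℂ (srcTrunc ℂ (fun Y : SrcLabel L M (nScales β + 1) => Y.2 = 1) 3
                                (klSrcAction L M β U μ (klFlowFrameU L M β U μ (nScales β + 1)) (nScales β + 1))) 2
                                ![((oc, ((⟨0, sectorCount_pos _⟩, 0), 0)), 1), (((t₁, oc.2 + ybar), ((⟨0, sectorCount_pos _⟩, 0), 1)), 1)] -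
                            kernel ℂ (srcTrunc ℂ (fun Y : SrcLabel L'' M (nScales β + 1) => Y.2 = 1) 3
                                (klSrcAction L'' M β U μ (klFlowFrameU L'' M β U μ (nScales β + 1)) (nScales β + 1))) 2
                                ![((of, ((⟨0, sectorCount_pos _⟩, 0), 0)), 1),
                                  (((t₁, of.2 + Torus.proj L'' (Torus.cRep ybar)), ((⟨0, sectorCount_pos _⟩, 0), 1)), 1)]‖) ≤ δ L ∧
                    klSrcPinnedSum L'' M β U μ (klFlowFrameU L'' M β U μ (nScales β + 1)) (nScales β + 1) 2 2 0
                      ((of, ((⟨0, sectorCount_pos _⟩, 0), 0)), 1) ≤ B) :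
    ∀ (G : GeoConsts) (P : SplitConsts) (Q : EngConsts) (R : RenConsts), G.WF → P.WF → Q.WF → R.WF →
      ∃ c₅ : ℝ, 0 < c₅ ∧ ∀ c : ℝ, 0 < c → c ≤ c₅ → ∃ U₀ : ℝ, 0 < U₀ ∧
        ∀ μ ∈ klWindowC, ∀ U : ℝ, 0 < U → U ≤ U₀ → ∀ β : ℝ, klBetaMin ≤ β → β ≤ Real.exp (c / U ^ 2) →
          ∀ K : TrigPolyC4v, klPredsV17F2.frameOK R U (nScales β) μ K →
            ∀ (Lstar : ℕ) (Mstar : ℕ → ℕ), TowerP klPredsV17F2 G P Q R β U μ K Lstar Mstar →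
              ∀ n : ℤ, ∃ L₀ : ℕ, ∃ ρ : ℕ → ℝ, Tendsto ρ atTop (𝓝 0) ∧
                ∀ (L : ℕ) [NeZero L], L₀ ≤ L → ∀ (L'' : ℕ) [NeZero L''], L ∣ L'' → ∃ M₀ : ℕ, ∀ (M : ℕ) [NeZero M], M₀ ≤ M →
                  ∀ (ω : MatsubaraIdx M), matsubaraInt M ω = n → ∀ (k : TorusSite 2 L) (k'' : TorusSite 2 L''),
                    latticeMomentum L'' k'' = latticeMomentum L k →
                      ‖klSelfEnergy L M β U μ (klFlowFrameU L M β U μ (nScales β + 1)) klE0 (nScales β + 1) (ω, k) 0 -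
                          klSelfEnergy L'' M β U μ (klFlowFrameU L'' M β U μ (nScales β + 1)) klE0 (nScales β + 1) (ω, k'') 0‖ ≤ ρ L := by
  refine framedNestedFlowTextV17F2_of_plainNearDefect_weightedRows fun G P Q R hG hP hQ hR => ?_
  obtain ⟨c₅, hc₅, hc⟩ := hD G P Q R hG hP hQ hR
  refine ⟨c₅, hc₅, fun c hc0 hcc => ?_⟩
  obtain ⟨U₀, hU₀, hU⟩ := hc c hc0 hcc
  refine ⟨U₀, hU₀, fun μ hμ U hU0 hUU β hβmin hβmax K hK Lstar Mstar hT => ?_⟩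
  have hβ : 0 < β := pos_of_klBetaMin_le hβmin
  obtain ⟨L₀, δ, B, hδ, hDn⟩ := hU μ hμ U hU0 hUU β hβmin hβmax K hK Lstar Mstar hT
  refine ⟨L₀, δ, B, hδ, fun L _ hL L'' _ b hb => ?_⟩
  obtain ⟨M₀, hM₀⟩ := hDn L hL L'' b hb
  refine ⟨M₀, fun M _ hM => ?_⟩
  obtain ⟨oc, of, ht, hnear, hB⟩ := hM₀ M hM
  refine ⟨oc, of, ht, ?_, (weightedRows_le_klSrcPinnedSum hβ.le U μ _ (nScales β + 1) of).trans hB⟩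
  simpa only [kernel_srcTrunc_klSrcAction_pair] using hnear

end Summit.HubbardSuperconductivity.HubbardSuperconductivity.Theorems.TwoPointAssembly

end
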